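import Summits.NavierStokesRegularity.NavierStokesRegularity.Theorems.AxisTwistDoorAveragedConeLiouvilleAxisLift
import Summits.NavierStokesRegularity.NavierStokesRegularity.Theorems.AxisTwistDoorAveragedConeLiouvilleRadialDrift
import HarnessLib

/-!
# Route `AxisTwistDoor`, crux `AveragedConeLiouville` (stmt-NavierStokesRegularity-26889), line `lrt_shell` v6, stub (5b-ii)
# `stub_axisHarnackChain` — brick B1′: the comparison function `V = M − Γ̂` CARRIES THE CYLINDER DATA off the axis

For a function `Γ(r,z,s)`, `C²` on `s < 0`, non-decreasing in `r ≥ 0`, the comparison function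
`V(t,x) = M − Γ(|x_h|, x₃, t)` (brick H1 `AxisLift.lift`) and the radial drift `b(x) = ((2 − C_d)/|x_h|²) x_h`
(brick C4 `RadialDrift`) satisfy, on the open off-axis region `U_{r₀} = {t < 0} × {|x_h| > r₀}`, exactly the
regularity / drift / supersolution hypotheses consumed by the positivity-propagation cylinders of the Harnack chain
(Lei–Ren–Tian arXiv:2501.08976 §4 p. 11, the passage "Applying Lemma 2.5 to V in 𝒟₁ viewed as a 3D axisymmetric
domain", made explicit):

* `isOpen_offAxisRegion`, `contDiffOn_comparison` (`V ∈ C²(U_{r₀})` jointly in `(t,x)`), `contDiffOn_drift`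
  (`b ∈ C¹(U_{r₀})`), `norm_drift_le`, `divergence_drift`;
* `deriv_r_nonneg` — monotonicity in `r` gives `∂ᵣΓ ≥ 0` at `r > 0` (no differentiability needed);
* `supersolution_comparison` — eq. Gamma-34 in the form `∂ₛΓ − ∂_z²Γ − ∂ᵣ²Γ + (r⁻¹ − C_d)∂ᵣΓ ≤ 0` (the registered
  `AxisCirculationData`, brick F4) at an off-axis point with `r ≤ 1`, `C_d ≥ 0` implies AxisLift's form with the
  WEAKENED coefficient `((1 − C_d)/r)∂ᵣΓ` (since `∂ᵣΓ ≥ 0`), hence `∂ₜV − ΔV + ⟪b, ∇V⟫ ≥ 0` with the divergence-free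
  drift `b = ((2 − C_d)/r) e_r = RadialDrift (2 − C_d)` (`radialDrift_eq_smul_eR`);
* small geometry: `cylRadius_le_cylRadius_add_dist` (`|x_h| ≤ |y_h| + dist x y`).

Width seat ns-in-wu-341 g2 under LEAD ns-atd-p1 (card §Chain plan, step 1).
[cite: LeiRenTian2025, §4 (arXiv:2501.08976, p. 11)]

WHAT THIS IS NOT: not a statement about Navier–Stokes regularity; multivariable calculus for a STAGED door route.
-/

noncomputable section

-- the summit and its single sub-problem share the name (CONVENTIONS §1)
set_option linter.dupNamespace false

namespace Summit.NavierStokesRegularity.NavierStokesRegularity.Theorems.AveragedConeLiouville.HarnackChainData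

open scoped InnerProductSpace Laplacian Topology
open Set Function Filter Metric
open Literature.Analysis Literature.Analysis.FluidPDE
open Summit.NavierStokesRegularity.NavierStokesRegularity.Theorems.AxisTwistDoorAveragedConeLiouvilleAxisLift

/-! ### Small geometry of the cylindrical radius -/

/-- The horizontal part written two ways. [folklore] -/
theorem toLp_horizontal_eq (x : EuclideanSpace ℝ (Fin 3)) :
    (WithLp.toLp 2 ![x 0, x 1, 0] : EuclideanSpace ℝ (Fin 3)) =
      x 0 • EuclideanSpace.single (0 : Fin 3) (1 : ℝ) + x 1 • EuclideanSpace.single (1 : Fin 3) (1 : ℝ) := by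
  ext i
  rw [RadialDrift.horizontal_apply]
  fin_cases i <;> simp

/-- The cylindrical radius is `1`-Lipschitz, one-sided form: `|x_h| ≤ |y_h| + dist x y` (the tree has the two-sided
form as `abs_cylRadius_sub_cylRadius_le` in another route's file; this is the shape the chain uses). [folklore] -/
theorem cylRadius_le_cylRadius_add_dist (x y : EuclideanSpace ℝ (Fin 3)) : cylRadius x ≤ cylRadius y + dist x y := by
  have hle : ∀ w : EuclideanSpace ℝ (Fin 3), cylRadius w ≤ ‖w‖ := fun w => by
    rw [EuclideanSpace.norm_eq, cylRadius, Fin.sum_univ_three]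
    simp only [Real.norm_eq_abs, sq_abs]
    exact Real.sqrt_le_sqrt (by nlinarith [sq_nonneg (w 2)])
  have hx : cylRadius x = ‖x 0 • EuclideanSpace.single (0 : Fin 3) (1 : ℝ) + x 1 • EuclideanSpace.single (1 : Fin 3) (1 : ℝ)‖ :=
    (RadialDrift.norm_horizontal x).symm
  have hy : cylRadius y = ‖y 0 • EuclideanSpace.single (0 : Fin 3) (1 : ℝ) + y 1 • EuclideanSpace.single (1 : Fin 3) (1 : ℝ)‖ :=
    (RadialDrift.norm_horizontal y).symm
  have heq : x 0 • EuclideanSpace.single (0 : Fin 3) (1 : ℝ) + x 1 • EuclideanSpace.single (1 : Fin 3) (1 : ℝ) -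
      (y 0 • EuclideanSpace.single (0 : Fin 3) (1 : ℝ) + y 1 • EuclideanSpace.single (1 : Fin 3) (1 : ℝ)) =
      (x - y) 0 • EuclideanSpace.single (0 : Fin 3) (1 : ℝ) + (x - y) 1 • EuclideanSpace.single (1 : Fin 3) (1 : ℝ) := by
    simp only [PiLp.sub_apply, sub_smul]
    abel
  have h1 := norm_le_norm_add_norm_sub' (x 0 • EuclideanSpace.single (0 : Fin 3) (1 : ℝ) + x 1 • EuclideanSpace.single (1 : Fin 3) (1 : ℝ))
    (y 0 • EuclideanSpace.single (0 : Fin 3) (1 : ℝ) + y 1 • EuclideanSpace.single (1 : Fin 3) (1 : ℝ))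
  rw [heq, RadialDrift.norm_horizontal (x - y)] at h1
  rw [hx, hy, dist_eq_norm]
  exact h1.trans (by gcongr; exact hle (x - y))

/-- The radial drift of brick C4 is `(c/r) e_r` off the axis. [folklore] -/
theorem radialDrift_eq_smul_eR (c : ℝ) {x : EuclideanSpace ℝ (Fin 3)} (hx : cylRadius x ≠ 0) :
    (c / cylRadius x ^ 2) • (x 0 • EuclideanSpace.single (0 : Fin 3) (1 : ℝ) + x 1 • EuclideanSpace.single (1 : Fin 3) (1 : ℝ)) =
      (c / cylRadius x) • eR x := by
  rw [eR, smul_smul, toLp_horizontal_eq]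
  congr 1
  field_simp

/-! ### The off-axis region and the regularity of `V` and `b` -/

/-- The off-axis region `{t < 0} × {|x_h| > r₀}` is open. [folklore] -/
theorem isOpen_offAxisRegion (r₀ : ℝ) :
    IsOpen {p : ℝ × EuclideanSpace ℝ (Fin 3) | p.1 < 0 ∧ r₀ < cylRadius p.2} :=
  (isOpen_lt continuous_fst continuous_const).inter
    (isOpen_lt continuous_const (continuous_cylRadius.comp continuous_snd))

variable {Γ : ℝ → ℝ → ℝ → ℝ}

/-- **`V = M − Γ̂` is `C²` on the off-axis region**, jointly in `(t,x)` (`Γ ∈ C²` on `s < 0`, `|x_h|` smooth off the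
axis). -/
theorem contDiffOn_comparison (hΓ : ContDiffOn ℝ 2 (fun q : ℝ × ℝ × ℝ => Γ q.1 q.2.1 q.2.2) {q | q.2.2 < 0})
    (M : ℝ) {r₀ : ℝ} (hr₀ : 0 ≤ r₀) :
    ContDiffOn ℝ 2 (uncurry fun t x => M - lift Γ t x) {p : ℝ × EuclideanSpace ℝ (Fin 3) | p.1 < 0 ∧ r₀ < cylRadius p.2} := by
  have hg : ContDiffOn ℝ 2 (fun p : ℝ × EuclideanSpace ℝ (Fin 3) => ((cylRadius p.2, (p.2 2, p.1)) : ℝ × ℝ × ℝ))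
      {p : ℝ × EuclideanSpace ℝ (Fin 3) | p.1 < 0 ∧ r₀ < cylRadius p.2} := by
    intro p hp
    have hρ : cylRadius p.2 ≠ 0 := (hr₀.trans_lt hp.2).ne'
    have h1 : ContDiffAt ℝ 2 (fun p : ℝ × EuclideanSpace ℝ (Fin 3) => cylRadius p.2) p :=
      (contDiffAt_cylRadius hρ).comp p contDiffAt_snd
    have h2 : ContDiffAt ℝ 2 (fun p : ℝ × EuclideanSpace ℝ (Fin 3) => p.2 2) p := by fun_prop
    exact (h1.prodMk (h2.prodMk contDiffAt_fst)).contDiffWithinAt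
  have hmaps : MapsTo (fun p : ℝ × EuclideanSpace ℝ (Fin 3) => ((cylRadius p.2, (p.2 2, p.1)) : ℝ × ℝ × ℝ))
      {p : ℝ × EuclideanSpace ℝ (Fin 3) | p.1 < 0 ∧ r₀ < cylRadius p.2} {q | q.2.2 < 0} := fun p hp => hp.1
  have hcomp := hΓ.comp hg hmaps
  have heq : (uncurry fun t x => M - lift Γ t x) =
      fun p : ℝ × EuclideanSpace ℝ (Fin 3) => M - (fun q : ℝ × ℝ × ℝ => Γ q.1 q.2.1 q.2.2) (cylRadius p.2, (p.2 2, p.1)) := by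
    funext p; rfl
  rw [heq]
  exact contDiffOn_const.sub hcomp

/-- The drift `b(t,x) = RadialDrift c x` (time-independent) is `C¹` on the off-axis region. -/
theorem contDiffOn_drift (c : ℝ) {r₀ : ℝ} (hr₀ : 0 < r₀) :
    ContDiffOn ℝ 1 (uncurry fun (_ : ℝ) (x : EuclideanSpace ℝ (Fin 3)) =>
        (c / cylRadius x ^ 2) • (x 0 • EuclideanSpace.single (0 : Fin 3) (1 : ℝ) + x 1 • EuclideanSpace.single (1 : Fin 3) (1 : ℝ)))
      {p : ℝ × EuclideanSpace ℝ (Fin 3) | p.1 < 0 ∧ r₀ < cylRadius p.2} := by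
  have h := (RadialDrift.contDiffOn_radialDrift c hr₀).comp contDiff_snd.contDiffOn
    (fun p (hp : p ∈ {p : ℝ × EuclideanSpace ℝ (Fin 3) | p.1 < 0 ∧ r₀ < cylRadius p.2}) => hp.2)
  exact h

/-! ### Monotonicity in `r` gives `∂ᵣΓ ≥ 0` -/

/-- **`∂ᵣΓ ≥ 0` at `r > 0`** for a function non-decreasing in `r ≥ 0` (Mathlib's `deriv` of a monotone function). -/
theorem deriv_r_nonneg
    (hmono : ∀ s : ℝ, s < 0 → ∀ z r₁ r₂ : ℝ, 0 ≤ r₁ → r₁ ≤ r₂ → 0 ≤ Γ r₁ z s ∧ Γ r₁ z s ≤ Γ r₂ z s)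
    {s : ℝ} (hs : s < 0) {r : ℝ} (hr : 0 < r) (z : ℝ) : 0 ≤ deriv (fun r' => Γ r' z s) r := by
  have hmon : MonotoneOn (fun r' => Γ r' z s) (Ici (0 : ℝ)) :=
    fun r₁ hr₁ r₂ _ h12 => (hmono s hs z r₁ r₂ hr₁ h12).2
  have h := hmon.derivWithin_nonneg (x := r)
  rwa [derivWithin_of_mem_nhds (Ici_mem_nhds hr)] at h

/-! ### The supersolution property of the comparison function -/

/-- **`V = M − Γ̂` is a supersolution with the radial drift `RadialDrift (2 − C_d)`** at an off-axis point `x` with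
`|x_h| ≤ 1` and a negative time `t` where eq. Gamma-34 holds in the form of the registered `AxisCirculationData`
(`(r⁻¹ − C_d)∂ᵣΓ`, `C_d ≥ 0`): the coefficient is first weakened to `((1 − C_d)/r)∂ᵣΓ` using `∂ᵣΓ ≥ 0`, then brick H1
`supersolution_lift` applies. [cite: LeiRenTian2025, §4 (arXiv:2501.08976, p. 11)] -/
theorem supersolution_comparison (hΓ : ContDiffOn ℝ 2 (fun q : ℝ × ℝ × ℝ => Γ q.1 q.2.1 q.2.2) {q | q.2.2 < 0})
    (hmono : ∀ s : ℝ, s < 0 → ∀ z r₁ r₂ : ℝ, 0 ≤ r₁ → r₁ ≤ r₂ → 0 ≤ Γ r₁ z s ∧ Γ r₁ z s ≤ Γ r₂ z s)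
    {Cd : ℝ} (hCd : 0 ≤ Cd) (M : ℝ) {t : ℝ} (ht : t < 0) {x : EuclideanSpace ℝ (Fin 3)}
    (hx : 0 < cylRadius x) (hx1 : cylRadius x ≤ 1)
    (h34 : deriv (fun s' => Γ (cylRadius x) (x 2) s') t
      - deriv (fun z' => deriv (fun z'' => Γ (cylRadius x) z'' t) z') (x 2)
      - deriv (fun r' => deriv (fun r'' => Γ r'' (x 2) t) r') (cylRadius x)
      + ((cylRadius x)⁻¹ - Cd) * deriv (fun r' => Γ r' (x 2) t) (cylRadius x) ≤ 0) :
    0 ≤ deriv (fun τ => M - lift Γ τ x) t - (Δ (fun y => M - lift Γ t y)) x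
      + ⟪((2 - Cd) / cylRadius x ^ 2) •
          (x 0 • EuclideanSpace.single (0 : Fin 3) (1 : ℝ) + x 1 • EuclideanSpace.single (1 : Fin 3) (1 : ℝ)),
        gradient (fun y => M - lift Γ t y) x⟫_ℝ := by
  have hx0 : cylRadius x ≠ 0 := hx.ne'
  have hD : 0 ≤ deriv (fun r' => Γ r' (x 2) t) (cylRadius x) := deriv_r_nonneg hmono ht hx (x 2)
  -- weaken the coefficient: `(1 - Cd)/r ≤ r⁻¹ - Cd` for `r ≤ 1`, `Cd ≥ 0`
  have hcoef : (1 - Cd) / cylRadius x ≤ (cylRadius x)⁻¹ - Cd := by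
    rw [div_le_iff₀ hx, sub_mul, inv_mul_cancel₀ hx0]
    nlinarith
  have h34' : deriv (fun s' => Γ (cylRadius x) (x 2) s') t
      - deriv (fun z' => deriv (fun z'' => Γ (cylRadius x) z'' t) z') (x 2)
      - deriv (fun r' => deriv (fun r'' => Γ r'' (x 2) t) r') (cylRadius x)
      + ((1 - Cd) / cylRadius x) * deriv (fun r' => Γ r' (x 2) t) (cylRadius x) ≤ 0 := by
    have := mul_le_mul_of_nonneg_right hcoef hD
    linarith
  have h := supersolution_lift hΓ ht hx0 Cd M h34'
  rwa [← radialDrift_eq_smul_eR (2 - Cd) hx0] at h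

end Summit.NavierStokesRegularity.NavierStokesRegularity.Theorems.AveragedConeLiouville.HarnackChainData

end
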